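import Mathlib
import Summits.CriticalPhenomena.PercolationContinuityZ3.Theses.PercNonProliferation
import Summits.CriticalPhenomena.PercolationContinuityZ3.Theorems.PercNonProliferationPolynomialAssembly
import Literature.Probability.Percolation.HalfSpacePinnedPairs
import Literature.Probability.Percolation.PercolationProofs
import HarnessLib

/-!
# Route `PercNonProliferation` — the assembly (item `stmt-CriticalPhenomena-4459`)

Settles the route decl
`Summit.CriticalPhenomena.PercolationContinuityZ3.Theses.PercNonProliferation.Assembly`:

  `SpanningPiecesCount → DensityWhp → FreeBoxSparse → NonProliferation → PercolationContinuityZ3`.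

This is measure-theoretic bookkeeping (no percolation input beyond the four hypotheses and the two
standard facts "`{x ↔ y in S}` and `{|C(x)| = ∞}` are measurable", "a.s. only lattice edges are open").
Write `P = bondPercolation (zdGraph 3) (criticalProbI 3)`, `θ = θ(p_c)`, `B(n) = box 3 n`, `K_n = |B(n)|`,
`V_n(ω) = #{x ∈ B(n) : x ↔ ∞}`, `S_n(ω) = #{(x,y) ∈ B(n)² : x ↔ y in B(2n)}`,
`G_n = {at most M spanning box-clusters}` (typed through representatives, as in the route file).
Suppose `θ > 0`.

* `NonProliferation` gives `M`, `c > 0` with `P(G_n) ≥ c` for infinitely many `n`;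
* `DensityWhp` at `p_c`: `P(D_n) → 1`, `D_n = {V_n ≥ θ K_n / 2}` (a measurable event: `V_n` is a finite sum
  of indicators of the measurable events `{x ↔ ∞}`);
* `E[S_n] = Σ_{x,y∈B(n)} P(x ↔ y in B(2n)) ≤ Σ_{x,y∈B(2n)} P(x ↔ y in B(2n)) = FA₂(2n) K_{2n}² ≤ 64 FA₂(2n) K_n²`
  and `FA₂(2n) → 0` (`FreeBoxSparse` along `n ↦ 2n`), so by Markov `P(S_n ≥ δ K_n²) → 0` for every
  `δ > 0`; take `δ = θ² / (8(M+1))`;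
* for a large `n` of the subsequence the union bound leaves positive mass on
  `G_n ∩ D_n ∩ {S_n < δ K_n²} ∩ {ω ⊆ E(ℤ³)}` (the last event has full measure, `setBernoulli_ae_subset`),
  and at a configuration there `SpanningPiecesCount` gives
  `(θ K_n / 2)² ≤ V_n² ≤ M S_n ≤ M δ K_n² ≤ θ² K_n² / 8`, impossible since `θ K_n > 0`.

Hence `θ(p_c) = 0`, which is `PercolationContinuityZ3` (`percolationContinuityZ3_iff`).
The probabilistic skeleton is proved first on an abstract probability space (`nonProlifAssembly_abstract`,
`nonProlifAssembly_markov`), so that the long event terms of the route file enter only by unification.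
-/

namespace Summit.CriticalPhenomena.PercolationContinuityZ3.Theorems

open MeasureTheory Filter Topology
open Literature.Probability.Percolation Literature.Probability.LatticeModels
open Summit.CriticalPhenomena.PercolationContinuityZ3.Theses.PercNonProliferation

/-- The union-bound / arithmetic skeleton of the assembly on an abstract probability space.
Data: a level `θ > 0`, volumes `K_n > 0`, "density" and "pair count" variables `V_n, S_n`, good events
`G_n` of probability `≥ c > 0` along a subsequence, an almost sure event `A`, and the deterministic
count `V_n² ≤ M S_n` on `A ∩ G_n`.  If `P(V_n ≥ θ K_n/2) → 1` and `P(S_n ≥ δ K_n²) → 0` for every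
`δ > 0`, this is contradictory. -/
theorem nonProlifAssembly_abstract {Ω : Type*} [MeasurableSpace Ω] (P : Measure Ω)
    [IsProbabilityMeasure P] {θ c : ℝ} {M : ℕ} {K : ℕ → ℝ} {V S : ℕ → Ω → ℝ} {G : ℕ → Set Ω} {A : Set Ω}
    (hθ : 0 < θ) (hc : 0 < c) (hK : ∀ n, 0 < K n) (hA : P.real Aᶜ = 0)
    (hG : ∃ᶠ n in atTop, c ≤ P.real (G n))
    (hcount : ∀ n ω, ω ∈ A → ω ∈ G n → (V n ω) ^ 2 ≤ M * S n ω)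
    (hDm : ∀ n, MeasurableSet {ω | θ * K n / 2 ≤ V n ω})
    (hD : Tendsto (fun n => P.real {ω | θ * K n / 2 ≤ V n ω}) atTop (𝓝 1))
    (hS : ∀ δ : ℝ, 0 < δ → Tendsto (fun n => P.real {ω | δ * K n ^ 2 ≤ S n ω}) atTop (𝓝 0)) :
    False := by
  obtain ⟨δ, hδ⟩ : ∃ δ : ℝ, δ = θ ^ 2 / (8 * (M + 1)) := ⟨_, rfl⟩
  have hδ0 : 0 < δ := by rw [hδ]; positivity
  have hE1 : ∀ᶠ n in atTop, 1 - c / 3 < P.real {ω | θ * K n / 2 ≤ V n ω} :=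
    hD.eventually (eventually_gt_nhds (by linarith))
  have hE2 : ∀ᶠ n in atTop, P.real {ω | δ * K n ^ 2 ≤ S n ω} < c / 3 :=
    (hS δ hδ0).eventually (eventually_lt_nhds (by positivity))
  obtain ⟨n, hGn, hDn, hSn⟩ := (hG.and_eventually (hE1.and hE2)).exists
  have hDc : P.real {ω | θ * K n / 2 ≤ V n ω}ᶜ < c / 3 := by
    rw [probReal_compl_eq_one_sub (hDm n)]
    linarith
  -- union bound: `G_n ⊆ X ∪ D_nᶜ ∪ B_n ∪ Aᶜ` with `X` the fourfold intersection
  have hsub : G n ⊆ (G n ∩ {ω | θ * K n / 2 ≤ V n ω} ∩ {ω | δ * K n ^ 2 ≤ S n ω}ᶜ ∩ A) ∪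
      {ω | θ * K n / 2 ≤ V n ω}ᶜ ∪ {ω | δ * K n ^ 2 ≤ S n ω} ∪ Aᶜ := by
    intro ω hω
    by_cases hD' : ω ∈ {ω | θ * K n / 2 ≤ V n ω}
    · by_cases hB' : ω ∈ {ω | δ * K n ^ 2 ≤ S n ω}
      · exact Or.inl (Or.inr hB')
      · by_cases hA' : ω ∈ A
        · exact Or.inl (Or.inl (Or.inl ⟨⟨⟨hω, hD'⟩, hB'⟩, hA'⟩))
        · exact Or.inr hA'
    · exact Or.inl (Or.inl (Or.inr hD'))
  have hmono := measureReal_mono (μ := P) hsub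
  have hu1 := measureReal_union_le (μ := P)
    ((G n ∩ {ω | θ * K n / 2 ≤ V n ω} ∩ {ω | δ * K n ^ 2 ≤ S n ω}ᶜ ∩ A) ∪
      {ω | θ * K n / 2 ≤ V n ω}ᶜ ∪ {ω | δ * K n ^ 2 ≤ S n ω}) Aᶜ
  have hu2 := measureReal_union_le (μ := P)
    ((G n ∩ {ω | θ * K n / 2 ≤ V n ω} ∩ {ω | δ * K n ^ 2 ≤ S n ω}ᶜ ∩ A) ∪
      {ω | θ * K n / 2 ≤ V n ω}ᶜ) {ω | δ * K n ^ 2 ≤ S n ω}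
  have hu3 := measureReal_union_le (μ := P)
    (G n ∩ {ω | θ * K n / 2 ≤ V n ω} ∩ {ω | δ * K n ^ 2 ≤ S n ω}ᶜ ∩ A)
      {ω | θ * K n / 2 ≤ V n ω}ᶜ
  have hpos : 0 < P.real (G n ∩ {ω | θ * K n / 2 ≤ V n ω} ∩ {ω | δ * K n ^ 2 ≤ S n ω}ᶜ ∩ A) := by
    linarith
  obtain ⟨ω, ⟨⟨⟨hωG, hωD⟩, hωB⟩, hωA⟩⟩ := nonempty_of_measureReal_ne_zero hpos.ne'
  -- the arithmetic at the configuration `ω`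
  have h1 : θ * K n / 2 ≤ V n ω := hωD
  have h2 : ¬ δ * K n ^ 2 ≤ S n ω := hωB
  have h3 : (V n ω) ^ 2 ≤ M * S n ω := hcount n ω hωA hωG
  have hKn : 0 < K n := hK n
  have hM0 : (0 : ℝ) ≤ M := Nat.cast_nonneg M
  have h4 : (θ * K n / 2) ^ 2 ≤ (V n ω) ^ 2 := pow_le_pow_left₀ (by positivity) h1 2
  have h5 : (M : ℝ) * S n ω ≤ M * (δ * K n ^ 2) := mul_le_mul_of_nonneg_left (not_le.1 h2).le hM0
  have h6 : (M : ℝ) * δ ≤ θ ^ 2 / 8 := by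
    rw [hδ, mul_div_assoc', div_le_div_iff₀ (by positivity) (by positivity)]
    nlinarith [sq_nonneg θ]
  have h7 : (M : ℝ) * (δ * K n ^ 2) ≤ θ ^ 2 / 8 * K n ^ 2 := by
    rw [← mul_assoc]
    exact mul_le_mul_of_nonneg_right h6 (sq_nonneg _)
  have h8 : (θ * K n / 2) ^ 2 = θ ^ 2 * K n ^ 2 / 4 := by ring
  have h9 : 0 < θ ^ 2 * K n ^ 2 := by positivity
  linarith

/-- Markov step of the assembly on an abstract probability space: if `S_n ≥ 0` is integrable with
`E[S_n] ≤ u_n K_n²` and `u_n → 0`, then `P(S_n ≥ δ K_n²) ≤ u_n / δ → 0` for every `δ > 0`. -/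
theorem nonProlifAssembly_markov {Ω : Type*} [MeasurableSpace Ω] (P : Measure Ω)
    [IsProbabilityMeasure P] {K u : ℕ → ℝ} {S : ℕ → Ω → ℝ} (hK : ∀ n, 0 < K n) (hS0 : ∀ n ω, 0 ≤ S n ω)
    (hSi : ∀ n, Integrable (S n) P) (hES : ∀ n, ∫ ω, S n ω ∂P ≤ u n * K n ^ 2)
    (hu : Tendsto u atTop (𝓝 0)) {δ : ℝ} (hδ : 0 < δ) :
    Tendsto (fun n => P.real {ω | δ * K n ^ 2 ≤ S n ω}) atTop (𝓝 0) := by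
  have hbound : ∀ n, P.real {ω | δ * K n ^ 2 ≤ S n ω} ≤ u n / δ := by
    intro n
    have hmk := mul_meas_ge_le_integral_of_nonneg (Eventually.of_forall (hS0 n)) (hSi n) (δ * K n ^ 2)
    have hK2 : 0 < K n ^ 2 := pow_pos (hK n) 2
    rw [le_div_iff₀ hδ]
    refine le_of_mul_le_mul_right ?_ hK2
    calc P.real {ω | δ * K n ^ 2 ≤ S n ω} * δ * K n ^ 2
        = δ * K n ^ 2 * P.real {ω | δ * K n ^ 2 ≤ S n ω} := by ring
      _ ≤ ∫ ω, S n ω ∂P := hmk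
      _ ≤ u n * K n ^ 2 := hES n
  refine squeeze_zero (fun n => measureReal_nonneg) hbound ?_
  simpa using hu.div_const δ

/-- A filtered cardinality is a finite sum of indicators:
`#{b ∈ s : ω ∈ A_b} = Σ_{b∈s} 1_{A_b}(ω)` (as real numbers). -/
theorem nonProlifAssembly_card_filter_eq_sum_indicator {Ω β : Type*} (s : Finset β) (A : β → Set Ω)
    (ω : Ω) [DecidablePred fun b => ω ∈ A b] :
    (((s.filter fun b => ω ∈ A b).card : ℕ) : ℝ) = ∑ b ∈ s, (A b).indicator 1 ω := by
  rw [Finset.natCast_card_filter]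
  refine Finset.sum_congr rfl fun b _ => ?_
  by_cases hb : ω ∈ A b <;> simp [hb]

/-- A filtered cardinality over measurable events is a measurable (real-valued) function of the
configuration. -/
theorem nonProlifAssembly_measurable_card_filter {Ω β : Type*} [MeasurableSpace Ω] (s : Finset β)
    (A : β → Set Ω) (hA : ∀ b, MeasurableSet (A b)) [∀ ω, DecidablePred fun b => ω ∈ A b] :
    Measurable fun ω => (((s.filter fun b => ω ∈ A b).card : ℕ) : ℝ) := by
  have h : (fun ω => (((s.filter fun b => ω ∈ A b).card : ℕ) : ℝ)) =
      fun ω => ∑ b ∈ s, (A b).indicator 1 ω :=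
    funext fun ω => nonProlifAssembly_card_filter_eq_sum_indicator s A ω
  rw [h]
  exact Finset.measurable_sum s fun b _ => measurable_one.indicator (hA b)

/-- A filtered cardinality over measurable events is integrable on a probability space and its
expectation is the sum of the probabilities: `E #{b ∈ s : ω ∈ A_b} = Σ_{b∈s} P(A_b)`. -/
theorem nonProlifAssembly_integral_card_filter {Ω β : Type*} [MeasurableSpace Ω] (P : Measure Ω)
    [IsProbabilityMeasure P] (s : Finset β) (A : β → Set Ω) (hA : ∀ b, MeasurableSet (A b))
    [∀ ω, DecidablePred fun b => ω ∈ A b] :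
    Integrable (fun ω => (((s.filter fun b => ω ∈ A b).card : ℕ) : ℝ)) P ∧
      ∫ ω, (((s.filter fun b => ω ∈ A b).card : ℕ) : ℝ) ∂P = ∑ b ∈ s, P.real (A b) := by
  have h : (fun ω => (((s.filter fun b => ω ∈ A b).card : ℕ) : ℝ)) =
      fun ω => ∑ b ∈ s, (A b).indicator 1 ω :=
    funext fun ω => nonProlifAssembly_card_filter_eq_sum_indicator s A ω
  have hint : ∀ b ∈ s, Integrable (fun ω => (A b).indicator (1 : Ω → ℝ) ω) P :=
    fun b _ => (integrable_const (1 : ℝ)).indicator (hA b)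
  rw [h]
  refine ⟨integrable_finsetSum s hint, ?_⟩
  rw [integral_finsetSum s hint]
  exact Finset.sum_congr rfl fun b _ => integral_indicator_one (hA b)

/-- Volume doubling for the cubes of `ℤ³`: `|B(2n)|² ≤ 64 |B(n)|²` (`|B(2n)| = (4n+1)³ ≤ 8 (2n+1)³`). -/
theorem nonProlifAssembly_card_box_two_mul_sq_le (n : ℕ) :
    ((box 3 (2 * n)).card : ℝ) ^ 2 ≤ 64 * ((box 3 n).card : ℝ) ^ 2 := by
  have h8 : ((box 3 (2 * n)).card : ℝ) ≤ 8 * (box 3 n).card := by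
    rw [card_box, card_box]
    have h : (2 * (2 * n) + 1) ^ 3 ≤ 8 * (2 * n + 1) ^ 3 := by
      calc (2 * (2 * n) + 1) ^ 3 ≤ (2 * (2 * n + 1)) ^ 3 := Nat.pow_le_pow_left (by omega) 3
        _ = 8 * (2 * n + 1) ^ 3 := by ring
    exact_mod_cast h
  calc ((box 3 (2 * n)).card : ℝ) ^ 2 ≤ (8 * ((box 3 n).card : ℝ)) ^ 2 :=
        pow_le_pow_left₀ (Nat.cast_nonneg _) h8 2
    _ = 64 * ((box 3 n).card : ℝ) ^ 2 := by ring

open scoped Classical in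
/-- **Item `stmt-CriticalPhenomena-4459` (`Assembly`)**: the density count,
`SpanningPiecesCount → DensityWhp → FreeBoxSparse → NonProliferation → θ(p_c(ℤ³)) = 0`.
If `θ(p_c) > 0`: along the subsequence of `NonProliferation` the events `{N_n ≤ M}` (probability `≥ c`),
`{V_n ≥ θ|B(n)|/2}` (probability `→ 1`, `DensityWhp`), `{S_n < δ|B(n)|²}` (probability `→ 1` by
`FreeBoxSparse` at scale `2n`, `|B(2n)| ≤ 8|B(n)|` and Markov, `δ = θ²/(8(M+1))`) and the almost sure
`{ω ⊆ E(ℤ³)}` intersect, and there `SpanningPiecesCount` gives `(θ|B(n)|/2)² ≤ V_n² ≤ M S_n ≤ θ²|B(n)|²/8`,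
a contradiction. -/
theorem nonProlifAssembly_proof : Assembly := by
  unfold Assembly
  intro hCount hDensity hSparse hNP
  unfold SpanningPiecesCount at hCount
  unfold DensityWhp at hDensity
  unfold FreeBoxSparse at hSparse
  unfold NonProliferation at hNP
  refine Literature.Probability.Percolation.percolationContinuityZ3_iff.2 ?_
  by_contra hne
  have hθ0 : 0 ≤ theta (zdGraph 3) (0 : Site 3) (criticalProbI 3) := by
    unfold theta
    exact measureReal_nonneg
  have hθ : 0 < theta (zdGraph 3) (0 : Site 3) (criticalProbI 3) := lt_of_le_of_ne hθ0 (Ne.symm hne)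
  obtain ⟨M, c, hc, hfreq⟩ := hNP
  have hD := hDensity (criticalProbI 3)
  -- volumes
  have hK : ∀ n : ℕ, (0 : ℝ) < ((box 3 n).card : ℝ) := fun n =>
    Nat.cast_pos.2 (Finset.card_pos.2 (box_nonempty 3 n))
  -- almost surely only lattice edges are open
  have hA : (bondPercolation (zdGraph 3) (criticalProbI 3)).real
      {ω : BondConfig (Site 3) | ω ⊆ (zdGraph 3).edgeSet}ᶜ = 0 := by
    have hae : ∀ᵐ ω ∂(bondPercolation (zdGraph 3) (criticalProbI 3)), ω ⊆ (zdGraph 3).edgeSet :=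
      ProbabilityTheory.setBernoulli_ae_subset
    rw [measureReal_eq_zero_iff]
    exact ae_iff.1 hae
  -- measurability of the percolation and connection events
  have hVm : ∀ n : ℕ, Measurable fun ω : BondConfig (Site 3) =>
      ((((box 3 n).filter fun x => ω ∈ percolatesAt x).card : ℕ) : ℝ) := fun n =>
    nonProlifAssembly_measurable_card_filter (box 3 n) (fun x => percolatesAt x)
      (fun x => measurableSet_percolatesAt_holds x)
  have hSI : ∀ n : ℕ, Integrable (fun ω : BondConfig (Site 3) =>
      ((((box 3 n ×ˢ box 3 n).filter fun q => ω ∈ openConnIn ↑(box 3 (2 * n)) q.1 q.2).card : ℕ) : ℝ))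
        (bondPercolation (zdGraph 3) (criticalProbI 3)) ∧
      ∫ ω, ((((box 3 n ×ˢ box 3 n).filter fun q => ω ∈ openConnIn ↑(box 3 (2 * n)) q.1 q.2).card : ℕ) : ℝ)
        ∂(bondPercolation (zdGraph 3) (criticalProbI 3)) =
      ∑ q ∈ box 3 n ×ˢ box 3 n, (bondPercolation (zdGraph 3) (criticalProbI 3)).real
        (openConnIn ↑(box 3 (2 * n)) q.1 q.2) := fun n =>
    nonProlifAssembly_integral_card_filter (bondPercolation (zdGraph 3) (criticalProbI 3)) (box 3 n ×ˢ box 3 n)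
      (fun q : Site 3 × Site 3 => openConnIn (↑(box 3 (2 * n)) : Set (Site 3)) q.1 q.2)
      (fun q => measurableSet_openConnIn_of_countable _ _ _)
  -- `FreeBoxSparse` along `n ↦ 2n`
  have h2n : Tendsto (fun n : ℕ => 2 * n) atTop atTop :=
    tendsto_atTop_mono (fun n : ℕ => show n ≤ 2 * n by omega) tendsto_id
  have hu : Tendsto (fun n : ℕ => 64 * ((∑ x ∈ box 3 (2 * n), ∑ y ∈ box 3 (2 * n),
      (bondPercolation (zdGraph 3) (criticalProbI 3)).real (openConnIn ↑(box 3 (2 * n)) x y)) /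
        ((box 3 (2 * n)).card : ℝ) ^ 2)) atTop (𝓝 0) := by
    have h := (hSparse.comp h2n).const_mul 64
    rw [mul_zero] at h
    exact h
  -- the expectation bound `E[S_n] ≤ 64 FA₂(2n) |B(n)|²`
  have hES : ∀ n : ℕ,
      ∫ ω, ((((box 3 n ×ˢ box 3 n).filter fun q => ω ∈ openConnIn ↑(box 3 (2 * n)) q.1 q.2).card : ℕ) : ℝ)
        ∂(bondPercolation (zdGraph 3) (criticalProbI 3)) ≤
      64 * ((∑ x ∈ box 3 (2 * n), ∑ y ∈ box 3 (2 * n),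
        (bondPercolation (zdGraph 3) (criticalProbI 3)).real (openConnIn ↑(box 3 (2 * n)) x y)) /
          ((box 3 (2 * n)).card : ℝ) ^ 2) * ((box 3 n).card : ℝ) ^ 2 := by
    intro n
    rw [(hSI n).2, Finset.sum_product]
    have hT0 : 0 ≤ ∑ x ∈ box 3 (2 * n), ∑ y ∈ box 3 (2 * n),
        (bondPercolation (zdGraph 3) (criticalProbI 3)).real (openConnIn ↑(box 3 (2 * n)) x y) :=
      Finset.sum_nonneg fun x _ => Finset.sum_nonneg fun y _ => measureReal_nonneg
    have hc2 : ((box 3 (2 * n)).card : ℝ) ^ 2 ≠ 0 := (pow_pos (hK (2 * n)) 2).ne'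
    calc ∑ x ∈ box 3 n, ∑ y ∈ box 3 n,
          (bondPercolation (zdGraph 3) (criticalProbI 3)).real (openConnIn ↑(box 3 (2 * n)) x y)
        ≤ ∑ x ∈ box 3 (2 * n), ∑ y ∈ box 3 (2 * n),
          (bondPercolation (zdGraph 3) (criticalProbI 3)).real (openConnIn ↑(box 3 (2 * n)) x y) :=
          polynomialAssembly_sum_sum_mono (box_mono 3 (by omega)) fun x y => measureReal_nonneg
      _ = (∑ x ∈ box 3 (2 * n), ∑ y ∈ box 3 (2 * n),
          (bondPercolation (zdGraph 3) (criticalProbI 3)).real (openConnIn ↑(box 3 (2 * n)) x y)) /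
            ((box 3 (2 * n)).card : ℝ) ^ 2 * ((box 3 (2 * n)).card : ℝ) ^ 2 :=
          (div_mul_cancel₀ _ hc2).symm
      _ ≤ (∑ x ∈ box 3 (2 * n), ∑ y ∈ box 3 (2 * n),
          (bondPercolation (zdGraph 3) (criticalProbI 3)).real (openConnIn ↑(box 3 (2 * n)) x y)) /
            ((box 3 (2 * n)).card : ℝ) ^ 2 * (64 * ((box 3 n).card : ℝ) ^ 2) :=
          mul_le_mul_of_nonneg_left (nonProlifAssembly_card_box_two_mul_sq_le n) (div_nonneg hT0 (sq_nonneg _))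
      _ = _ := by ring
  -- `P(S_n ≥ δ |B(n)|²) → 0` for every `δ > 0`
  have hS : ∀ δ : ℝ, 0 < δ → Tendsto (fun n : ℕ => (bondPercolation (zdGraph 3) (criticalProbI 3)).real
      {ω : BondConfig (Site 3) | δ * ((box 3 n).card : ℝ) ^ 2 ≤
        ((((box 3 n ×ˢ box 3 n).filter fun q => ω ∈ openConnIn ↑(box 3 (2 * n)) q.1 q.2).card : ℕ) : ℝ)})
      atTop (𝓝 0) := fun δ hδ =>
    nonProlifAssembly_markov (bondPercolation (zdGraph 3) (criticalProbI 3)) hK (fun n ω => Nat.cast_nonneg _)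
      (fun n => (hSI n).1) hES hu hδ
  -- the abstract skeleton does the rest
  refine nonProlifAssembly_abstract (bondPercolation (zdGraph 3) (criticalProbI 3)) (M := M) hθ hc hK hA hfreq
    (V := fun n ω => ((((box 3 n).filter fun x => ω ∈ percolatesAt x).card : ℕ) : ℝ)) ?_
    (fun n => measurableSet_le measurable_const (hVm n)) hD hS
  intro n ω hωA hωG
  exact_mod_cast hCount M n ω hωA hωG

end Summit.CriticalPhenomena.PercolationContinuityZ3.Theorems
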